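import Summits.BirchSwinnertonDyer.Rank1Residual.Additive.RamifiedSevenPadicNormKernels

/-!
# K2C-9R port 2/4 (§C+§D): the datum `KatoExpPadicDatum hγ Φ` (7-adic ★-constants `(α₀, α₁) ∈ ℤ₇² ∖ {0}`), `KatoExpPadicCompatShape`, the §2 API re-issued, and the explicit data of block (R) (`xTilde`, `cZ`, `normA`, `jα = v₇(N(α))`, `wα`)

PORT (cell bsd-cm, seat bsd-cm-k-ty1 g32; row K2C-9R of crux `EllipticUnitValueSevenOfGZK`, route K7r) of the DRAFT-OF-RECORD
`Cruxes/EllipticUnitValueSevenOfGZK/K2C9RKatoExpDatumPadic_g80.lean` (bsd-idea-20 g80, tree f21b9ca41d3d0893, 1342 l.; pen GO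
D1086 (II) (c1)–(c4), letter of record D1087 (II), port rules (p1)–(p4): namespace `…Additive.GenusSeven`, four files split at the
`## §` headers (§A | §C+§D | §B+§E | §F+§G), the landed `KatoExpDatum` / K2C-9 files / `RamifiedSevenPeriodPositionKernel.lean`
untouched, 0 facts, cite tags carried).  Declarations = the draft's, VERBATIM (statements and proofs), only re-homed.
WHY (pen D1085 (ρ1)): Kato's constant of (15.16.1) for the `Λˣ`-normalised ★-class lives in `(O_K ⊗ ℤ₇) ∖ {0}`, not in `O_K`;
the padic datum re-types the pair `(α₀, α₁)` 7-adically and block (R), (KI)-R, (PK)-R go through with the same binders and the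
SAME conclusions, the period-position exponent becoming `jα = v₇(α₀² + 7α₁²)`.

WHAT THIS FILE HOLDS (the draft's docstring for its sections):
§C THE DATUM `KatoExpPadicDatum hγ Φ` (c1) + `KatoExpPadicCompatShape` (:= `Nonempty`) + `katoExpPadicCompatShape_iff` +
  the datum-free `ne_zero_of_padicValueLaw` (successor of `PinnedKatoGenusFrame.ne_zero_of_valueLaw`) + the §2 API of
  `RamifiedSevenGenusKatoExpDatum.lean` re-issued VERBATIM in `namespace KatoExpPadicDatum` (`val_smul_piK`, `val_intCast_smul`,
  NEW `val_algebraMap_smul` (`algebraMap ℤ₇ Λ = PowerSeries.C`), `sigma`, `sigma_def`, `exists_nat_toZModPow_artExp`,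
  `inv_heckeIdealValue_eq_pow`, `val_sigma_smul_eq_pow`, ★ eigen-lemma `val_sigma_smul`, `charEval_sigma`, `val_zStar_ne_zero`).
§D THE EXPLICIT DATA of block (R), 7-adic currency: `xTilde`/`xTilde_def` VERBATIM; `cZ := (A(C α₀) − A(C α₁)·π)·A((7^e : ℤ))·
  (A(uStar⁻¹)·(A(7^k)·(u·π^a)))` (`A = algebraMap Λ Λ_O`, `C = PowerSeries.C : ℤ₇ →+* Λ`; (c4): the pair enters ONLY through
  `algebraMap ∘ C`, no `ι₇`); `normA : ℤ_[7] := α₀² + 7α₁²`, `normA_ne_zero`; `jα : ℕ := D.normA.valuation` ((c4), Mathlib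
  `PadicInt.valuation (x : ℤ_[p]) : ℕ := (x : ℚ_[p]).valuation.toNat`, `Mathlib/NumberTheory/Padics/PadicIntegers.lean`);
  `normUnit := PadicInt.unitCoeff _ : ℤ_[7]ˣ`, `normA_eq_normUnit_mul_pow`, `seven_pow_jα_dvd_normA`; `wα := v^{jα}·A(2·C normUnit)`,
  `isUnit_wα`; `C_two_mul_normA`, `sTwoSided_eq` (`π^{m₀}·A(C(2N(α))) = wα·π^{m₀+2jα}`), `C_sq_add_seven_mul_C_sq_ne_zero`,
  `two_mul_C_sq_add_eq`, `cZ_eq`, and (PK)-R's `pow_dvd_cZ_mul_of_leAt`/`pow_dvd_cZ_mul_of_le` (same letters as the tree's).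
(c1) CHECK: the structure block and `KatoExpPadicCompatShape` below are letter-identical to l.519–590 of f21b9ca41d3d0893 (pen word D1087 (p2)).

HONEST LABEL: infrastructure (kernel lemmas / a hypothesis structure / definitions / conditional implications); it closes no
item, registers no stub, proves no summit statement; every ★/★′/★″ is CONDITIONAL on its displayed binders; nothing is asserted
to exist; stmt-BirchSwinnertonDyer-19945 is OPEN; `X12.CMRamifiedSeven` is NOT proved; BSD is claimed for no curve.  No `sorry`,
no `instance`, no `notation`/`macro`, no named fact, no attribute removed.

References: [Kato2004Asterisque] K. Kato, p-adic Hodge theory and values of zeta functions of modular forms, Astérisque 295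
(2004): Thm. 12.4 (2) / 12.5 (1) (p. 221), 13.5 (p. 227), §13.9 (p. 230), Prop. 15.9 (15.9.1) (pp. 258–259), (15.12.2)
(p. 263), 15.14 (p. 264), §15.16 (15.16.1) (p. 265); [BlochKato1990] S. Bloch, K. Kato, L-functions and Tamagawa numbers of
motives, Def. 3.10, Ex. 3.10.1–3.11 (pp. 359–361); [Washington1997] L. Washington, Introduction to Cyclotomic Fields, §7.1
(Prop. 7.2), §13.2; [NeukirchSchmidtWingberg2008] J. Neukirch, A. Schmidt, K. Wingberg, Cohomology of Number Fields, XI §1–§2;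
[Serre1973] J.-P. Serre, A Course in Arithmetic, Ch. II §2 (squares in `ℚ_p`: `−7 ∉ (ℚ₇)²`).
-/

noncomputable section

open scoped NumberField TensorProduct
open Field IsDedekindDomain NumberField Polynomial
open Literature.NumberTheory.GaloisRepresentations
open Literature.NumberTheory.EllipticCurves
open Literature.NumberTheory.EllipticCurves.Rank1Residual
open Literature.NumberTheory.EllipticCurves.IwasawaAlgebra
open Literature.NumberTheory.EllipticCurves.Kato2004
open Literature.NumberTheory.ComplexMultiplication.EllipticUnits
open Summit.BirchSwinnertonDyer.Rank1Residual
open Summit.BirchSwinnertonDyer.Rank1Residual.Additive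

namespace Summit.BirchSwinnertonDyer.Rank1Residual.Additive.GenusSeven

/-! ## §C  The datum `KatoExpPadicDatum hγ Φ` (= `KatoExpDatum hγ Φ` with `α₀ α₁ : ℤ_[7]` and the (eZ′) reading through `ι₇`),
the `Prop` `KatoExpPadicCompatShape`, and the §2 API re-issued -/

section Frame

variable {W : WeierstrassCurve ℚ} [W.IsElliptic] [W.IsGloballyMinimal] [Fact (Nat.Prime 7)]
  [ContinuousSMul ℤ_[7] (W.tateModule 7)] {K : ZpExtension ℚ 7} {hK : K.IsCyclotomic}
  {γ : Field.absoluteGaloisGroup ℚ} {I : IwasawaH1Data W 7 K γ}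
  {F : GenusFrame} {θu : ∀ n : ℕ, globalUnitsOf (F.layer n)} {d : GenusDatum F θu}

/-- **`KatoExpPadicDatum hγ Φ` — the `χ`-components of the dual exponential on `𝐇′(S′_W) = Φ.IK.H`, read in ℂ, with Kato's
value laws for the (λ1) classes `euK 𝔟` and for the ★-class, the ★-CONSTANT `α = α₀ + α₁√−7` A 7-ADIC PAIR `(α₀, α₁) ∈ ℤ₇²`**
(successor of `KatoExpDatum hγ Φ`, pen D1085 (ρ1)/(III) = row K2C-9R; hazard (H-γ) of `StarValuePin_g79.md` REV 1.1 §8):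
every field is LETTER-IDENTICAL to `KatoExpDatum` (`RamifiedSevenGenusKatoExpDatum.lean` :130–199) except `α₀ α₁ : ℤ_[7]`
(there `: ℤ`), and (eZ′) `val_zStar`, whose right side reads the pair through the datum's own `ι₇ : ℚ₇ → ℂ`:
`(ι₇ α₀ + ι₇ α₁·ιC(√−7))·Ω⁻¹·Lf 1` (there `((α₀ : ℂ) + (α₁ : ℂ)·ιC(√−7))·Ω⁻¹·Lf 1`).  `α_ne_zero` keeps its letter at the
new type.  A HYPOTHESIS STRUCTURE; nothing is asserted to exist; no named fact.
[cite: Kato2004Asterisque, Prop. 15.9 (15.9.1) (pp. 258–259), Thm. 12.5 (1) (p. 221), (15.12.2) (p. 263), 15.14 (p. 264), (15.16.1) (p. 265), §15.7 (p. 256)]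
[cite: BlochKato1990, Def. 3.10 and Ex. 3.10.1–3.11 (pp. 359–361)] [cite: NeukirchSchmidtWingberg2008, XI §1–§2] -/
structure KatoExpPadicDatum (hγ : K.IsTopGenerator γ) (Φ : PinnedKatoGenusFrame W K hK I d) : Type where
  /-- A complex reading of `7`-adic coefficients. -/
  ι₇ : ℚ_[7] →+* ℂ
  /-- The `χ`-component of `exp*` on `𝐇′(S′_W)`, read in ℂ, for every continuous character `χ` of `Γ_{Kcm}`. -/
  val : (absoluteGaloisGroup Φ.Kcm →ₜ* ℂˣ) → (Φ.IK.H →+ ℂ)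
  /-- (e1) naturality of `exp*`: `γK` acts on the `χ`-component by `χ(γK)⁻¹`, for `χ` of finite level. -/
  val_T : ∀ (χ : absoluteGaloisGroup Φ.Kcm →ₜ* ℂˣ),
    (∃ n : ℕ, ∀ σ ∈ (K.restrictOfFinrankEqTwo (by decide) Φ.Kcm Φ.finrank_Kcm).layerSubgroup n, χ σ = 1) →
    ∀ (x : Φ.IK.H),
      val χ ((1 + PowerSeries.X : IwasawaAlgebra 7) • x) = (((χ Φ.γK)⁻¹ : ℂˣ) : ℂ) * val χ x
  /-- (e1′) `ℤ₇`-linearity, read through `ι₇`, for `χ` of finite level. -/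
  val_C : ∀ (χ : absoluteGaloisGroup Φ.Kcm →ₜ* ℂˣ),
    (∃ n : ℕ, ∀ σ ∈ (K.restrictOfFinrankEqTwo (by decide) Φ.Kcm Φ.finrank_Kcm).layerSubgroup n, χ σ = 1) →
    ∀ (c : ℤ_[7]) (x : Φ.IK.H),
      val χ ((PowerSeries.C c : IwasawaAlgebra 7) • x) = ι₇ (c : ℚ_[7]) * val χ x
  /-- (e2) CM-functoriality: the CM operator `piK` (`= (T₇φ)_*`) acts on values by `ιC(√−7)`, for `χ` of finite level. -/
  val_piK : ∀ (χ : absoluteGaloisGroup Φ.Kcm →ₜ* ℂˣ),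
    (∃ n : ℕ, ∀ σ ∈ (K.restrictOfFinrankEqTwo (by decide) Φ.Kcm Φ.finrank_Kcm).layerSubgroup n, χ σ = 1) →
    ∀ (x : Φ.IK.H),
      val χ (Φ.piK x) = Φ.ιC (algebraMap Φ.Kcm (AlgebraicClosure Φ.Kcm) Φ.sqrtNegSeven) * val χ x
  /-- (eV) the values of the elliptic-unit classes: (15.9.1) on the cyclotomic layer `Kℚ_n` (= the frame's (Z4)(Z5)). -/
  val_euK : ∀ (𝔟 : Ideal (𝓞 Φ.Kcm)), IsTwist 7 Φ.𝔣 𝔟 → ∀ (n : ℕ) (χ : absoluteGaloisGroup Φ.Kcm →ₜ* ℂˣ),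
    (∀ σ ∈ (K.restrictOfFinrankEqTwo (by decide) Φ.Kcm Φ.finrank_Kcm).layerSubgroup n, χ σ = 1) →
    ∀ Lf : ℂ → ℂ, CM.IsDepletedHeckeL Φ.ψ χ (7 * (7 * F.d)) Lf →
      val χ (Φ.euK 𝔟) =
        (((Ideal.absNorm 𝔟 : ℕ) : ℂ) - CM.heckeCharIdealValue Φ.ψ 𝔟 * (heckeIdealValue χ 𝔟)⁻¹) * Φ.Ω⁻¹ * Lf 1
  /-- (eZ) the ★-unit and the `Λˣ`-normalised ★-class `zStar` (`uStar • zStar = res zOne`) … -/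
  uStar : (IwasawaAlgebra 7)ˣ
  zStar : Φ.IK.H
  uStar_smul_zStar : ((uStar : IwasawaAlgebra 7)) • zStar = I.resOver Φ.IK hγ Φ.isTopGenerator_γK Φ.zOne
  /-- … its value constants: a `7`-power `7^e`, a 7-ADIC PAIR `α = α₀ + α₁√−7 ∈ (K ⊗ ℚ₇)^×` read INTEGRALLY in `ℤ₇²`
  (pen D1085 (ρ1): Kato's constant of (15.16.1) lives in `(O_K ⊗ ℤ₇) ∖ {0}`, not in `O_K`), a threshold `n₀` … -/
  e : ℕ
  α₀ : ℤ_[7]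
  α₁ : ℤ_[7]
  α_ne_zero : α₀ ≠ 0 ∨ α₁ ≠ 0
  n₀ : ℕ
  /-- (eZ′) … and its value law at characters of PRIMITIVE level `n + 1`, `n ≥ n₀`, the pair READ THROUGH `ι₇`. -/
  val_zStar : ∀ (n : ℕ), n₀ ≤ n → ∀ (χ : absoluteGaloisGroup Φ.Kcm →ₜ* ℂˣ),
    (∀ σ ∈ (K.restrictOfFinrankEqTwo (by decide) Φ.Kcm Φ.finrank_Kcm).layerSubgroup (n + 1), χ σ = 1) →
    IsPrimitiveRoot (((χ Φ.γK : ℂˣ)) : ℂ) (7 ^ (n + 1)) →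
    ∀ Lf : ℂ → ℂ, CM.IsDepletedHeckeL Φ.ψ χ (7 * (7 * F.d)) Lf →
      (7 : ℂ) ^ e * val χ zStar =
        (ι₇ (α₀ : ℚ_[7]) + ι₇ (α₁ : ℚ_[7]) * Φ.ιC (algebraMap Φ.Kcm (AlgebraicClosure Φ.Kcm) Φ.sqrtNegSeven)) *
          Φ.Ω⁻¹ * Lf 1
  /-- (psiK) `ψ(𝔟) ∈ O_K = ℤ[(1+√−7)/2]`: the integer coordinates `2ψ(𝔟) = b₀(𝔟) + b₁(𝔟)√−7` (Skolemised). -/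
  bCoef₀ : Ideal (𝓞 Φ.Kcm) → ℤ
  bCoef₁ : Ideal (𝓞 Φ.Kcm) → ℤ
  psi_eq : ∀ (𝔟 : Ideal (𝓞 Φ.Kcm)), IsTwist 7 Φ.𝔣 𝔟 →
    2 * CM.heckeCharIdealValue Φ.ψ 𝔟 =
      (bCoef₀ 𝔟 : ℂ) + (bCoef₁ 𝔟 : ℂ) * Φ.ιC (algebraMap Φ.Kcm (AlgebraicClosure Φ.Kcm) Φ.sqrtNegSeven)
  /-- (art) RE-TYPED: the `7`-ADIC Artin exponent `κ(𝔟) ∈ ℤ₇` of an admissible twist, `(𝔟, Kℚ_∞/K) = γK^{κ(𝔟)}`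
  (Skolemised) … -/
  artExp : Ideal (𝓞 Φ.Kcm) → ℤ_[7]
  /-- … and Artin reciprocity LEVEL-WISE: `χ(𝔟) = χ(γK)^m` for every `χ` trivial on `U_n` and every natural
  `m ≡ κ(𝔟) (mod 7^n)`. -/
  art : ∀ (𝔟 : Ideal (𝓞 Φ.Kcm)), IsTwist 7 Φ.𝔣 𝔟 → ∀ (n m : ℕ),
    PadicInt.toZModPow n (artExp 𝔟) = (m : ZMod (7 ^ n)) →
    ∀ (χ : absoluteGaloisGroup Φ.Kcm →ₜ* ℂˣ),
      (∀ σ ∈ (K.restrictOfFinrankEqTwo (by decide) Φ.Kcm Φ.finrank_Kcm).layerSubgroup n, χ σ = 1) →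
        heckeIdealValue χ 𝔟 = (((χ Φ.γK : ℂˣ)) : ℂ) ^ m

/-- **`KatoExpPadicCompatShape hγ Φ`** :≡ the pinned frame `Φ` ADMITS a dual-exponential value datum with 7-adic ★-constants —
the (r3) binder of block (R) over `KatoExpPadicDatum` (successor of `KatoExpCompatShape`).  A predicate (`Nonempty`); nothing
asserted. [cite: Kato2004Asterisque, Prop. 15.9 (p. 258), Thm. 12.5 (1) (p. 221), (15.16.1) (p. 265)] [cite: BlochKato1990, Def. 3.10 (p. 359)] -/
def KatoExpPadicCompatShape (hγ : K.IsTopGenerator γ) (Φ : PinnedKatoGenusFrame W K hK I d) : Prop :=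
  Nonempty (KatoExpPadicDatum hγ Φ)

/-- Unfolding `KatoExpPadicCompatShape`. [cite: Kato2004Asterisque, (15.16.1) (p. 265)] -/
theorem katoExpPadicCompatShape_iff (hγ : K.IsTopGenerator γ) (Φ : PinnedKatoGenusFrame W K hK I d) :
    KatoExpPadicCompatShape hγ Φ ↔ Nonempty (KatoExpPadicDatum hγ Φ) :=
  Iff.rfl

/-- A value `V` subject to a ★-type value law `7^e·V = (ι α₀ + ι α₁·ιC(√−7))·Ω⁻¹·L` with a 7-ADIC pair `(α₀, α₁) ≠ 0` and
`L ≠ 0` is NON-ZERO — datum-free form of «the values of the ★-class are non-zero where `L_{7f}(ψ̄, χ, 1) ≠ 0`» in the 7-adic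
currency (the reading `ℚ₇ ⊕ ℚ₇√−7 → ℂ` is injective because `−7` is not a square in `ℚ₇`); fed with (eZ′) by block (R).
[cite: Kato2004Asterisque, Thm. 12.5 (2) (p. 221) and 13.5 (p. 227)] -/
theorem ne_zero_of_padicValueLaw (Φ : PinnedKatoGenusFrame W K hK I d) (ι : ℚ_[7] →+* ℂ) {α₀ α₁ : ℤ_[7]}
    (hα : α₀ ≠ 0 ∨ α₁ ≠ 0) {e : ℕ} {V L : ℂ}
    (h : (7 : ℂ) ^ e * V = (ι (α₀ : ℚ_[7]) + ι (α₁ : ℚ_[7]) * Φ.ιC (algebraMap Φ.Kcm (AlgebraicClosure Φ.Kcm) Φ.sqrtNegSeven)) *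
      Φ.Ω⁻¹ * L) (hL : L ≠ 0) : V ≠ 0 := by
  intro h0
  rw [h0, mul_zero] at h
  exact mul_ne_zero (mul_ne_zero (padicReading_ne_zero ι _ Φ.ιC_sqrtNegSeven_sq hα) (inv_ne_zero Φ.Ω_ne_zero)) hL h.symm

namespace KatoExpPadicDatum

variable {hγ : K.IsTopGenerator γ} {Φ : PinnedKatoGenusFrame W K hK I d} (D : KatoExpPadicDatum hγ Φ)

/-- `val χ (f • piK y) = ιC(√−7)·val χ (f • y)` (χ of finite level). [cite: Kato2004Asterisque, §15.3 (p. 252) and 15.14 (p. 264)] -/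
theorem val_smul_piK (χ : absoluteGaloisGroup Φ.Kcm →ₜ* ℂˣ)
    (hχ : ∃ n : ℕ, ∀ σ ∈ (K.restrictOfFinrankEqTwo (by decide) Φ.Kcm Φ.finrank_Kcm).layerSubgroup n, χ σ = 1)
    (f : IwasawaAlgebra 7) (y : Φ.IK.H) :
    (D : KatoExpPadicDatum hγ Φ).val χ (f • Φ.piK y) = Φ.ιC (algebraMap Φ.Kcm (AlgebraicClosure Φ.Kcm) Φ.sqrtNegSeven) * D.val χ (f • y) := by
  rw [← Φ.piK_smul, D.val_piK χ hχ]

/-- Integer scalars pass through `val`: `val χ ((c : Λ) • x) = c·val χ x` (`ι₇` is the identity on ℤ; χ of finite level).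
[cite: Kato2004Asterisque, Thm. 12.5 (1) (p. 221)] -/
theorem val_intCast_smul (χ : absoluteGaloisGroup Φ.Kcm →ₜ* ℂˣ)
    (hχ : ∃ n : ℕ, ∀ σ ∈ (K.restrictOfFinrankEqTwo (by decide) Φ.Kcm Φ.finrank_Kcm).layerSubgroup n, χ σ = 1)
    (c : ℤ) (x : Φ.IK.H) :
    (D : KatoExpPadicDatum hγ Φ).val χ ((c : IwasawaAlgebra 7) • x) = (c : ℂ) * D.val χ x := by
  have h : ((c : IwasawaAlgebra 7)) = PowerSeries.C ((c : ℤ_[7])) := by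
    rw [map_intCast]
  rw [h, D.val_C χ hχ, PadicInt.coe_intCast, map_intCast]

/-- `ℤ₇`-scalars through the `ℤ₇`-ALGEBRA structure of `Λ` pass through `val` by `ι₇`: `val χ ((algebraMap ℤ₇ Λ c) • x) =
ι₇ c · val χ x` (`algebraMap ℤ₇ Λ = PowerSeries.C`; χ of finite level). [cite: Kato2004Asterisque, Thm. 12.5 (1) (p. 221)] -/
theorem val_algebraMap_smul (χ : absoluteGaloisGroup Φ.Kcm →ₜ* ℂˣ)
    (hχ : ∃ n : ℕ, ∀ σ ∈ (K.restrictOfFinrankEqTwo (by decide) Φ.Kcm Φ.finrank_Kcm).layerSubgroup n, χ σ = 1)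
    (c : ℤ_[7]) (x : Φ.IK.H) :
    (D : KatoExpPadicDatum hγ Φ).val χ ((algebraMap ℤ_[7] (IwasawaAlgebra 7) c) • x) = D.ι₇ (c : ℚ_[7]) * D.val χ x := by
  rw [← PowerSeries.C_eq_algebraMap, D.val_C χ hχ]

/-- **`D.sigma 𝔟 = σ_𝔟 := (1+X)^{κ(𝔟)} ∈ Λ`** — the image in `Λ = ℤ₇⟦X⟧` (`γK ↦ 1 + X`) of the Artin symbol
`(𝔟, Kℚ_∞/K) = γK^{κ(𝔟)}`: the binomial power series with the `7`-adic exponent `κ(𝔟) = D.artExp 𝔟`.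
[cite: Washington1997, §13.2] [cite: Kato2004Asterisque, (15.12.2) (p. 263)] -/
def sigma (𝔟 : Ideal (𝓞 Φ.Kcm)) : IwasawaAlgebra 7 :=
  PowerSeries.binomialSeries ℤ_[7] (D.artExp 𝔟)

/-- Unfolding `sigma`. [cite: Washington1997, §13.2] -/
theorem sigma_def (𝔟 : Ideal (𝓞 Φ.Kcm)) : (D : KatoExpPadicDatum hγ Φ).sigma 𝔟 = PowerSeries.binomialSeries ℤ_[7] (D.artExp 𝔟) := rfl

/-- Every level `n` has a natural lift `m ≡ κ(𝔟) (mod 7^n)`. [cite: NeukirchSchmidtWingberg2008, XI §1] -/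
theorem exists_nat_toZModPow_artExp (𝔟 : Ideal (𝓞 Φ.Kcm)) (n : ℕ) :
    ∃ m : ℕ, PadicInt.toZModPow n ((D : KatoExpPadicDatum hγ Φ).artExp 𝔟) = (m : ZMod (7 ^ n)) := by
  haveI : NeZero (7 ^ n) := ⟨pow_ne_zero n (by norm_num)⟩
  exact ⟨(PadicInt.toZModPow n (D.artExp 𝔟)).val, (ZMod.natCast_zmod_val _).symm⟩

/-- (art) inverted: `χ(𝔟)⁻¹ = (χ(γK)⁻¹)^m` for `χ` of level `n` and a natural lift `m ≡ κ(𝔟) (mod 7^n)`.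
[cite: NeukirchSchmidtWingberg2008, XI §2 (Artin map of a ℤ_p-extension)] -/
theorem inv_heckeIdealValue_eq_pow (χ : absoluteGaloisGroup Φ.Kcm →ₜ* ℂˣ) {n : ℕ}
    (hχ : ∀ σ ∈ (K.restrictOfFinrankEqTwo (by decide) Φ.Kcm Φ.finrank_Kcm).layerSubgroup n, χ σ = 1)
    {𝔟 : Ideal (𝓞 Φ.Kcm)} (h𝔟 : IsTwist 7 Φ.𝔣 𝔟) {m : ℕ}
    (hm : PadicInt.toZModPow n ((D : KatoExpPadicDatum hγ Φ).artExp 𝔟) = (m : ZMod (7 ^ n))) :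
    (heckeIdealValue χ 𝔟)⁻¹ = ((((χ Φ.γK)⁻¹ : ℂˣ)) : ℂ) ^ m := by
  rw [D.art 𝔟 h𝔟 n m hm χ hχ, Units.val_inv_eq_inv_val, inv_pow]

/-- `σ_𝔟` acts on the values at a level-`n` character by `(χ(γK)⁻¹)^m`, `m` any natural lift of `κ(𝔟) mod 7^n`
((e1) + `(χ γK)⁻¹ ^ 7^n = 1` + `(1+X)^{κ} ≡ (1+X)^m (mod ω_n)`). [cite: Washington1997, §13.2]
[cite: Kato2004Asterisque, Thm. 12.5 (1) (p. 221)] -/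
theorem val_sigma_smul_eq_pow (χ : absoluteGaloisGroup Φ.Kcm →ₜ* ℂˣ) {n : ℕ}
    (hχ : ∀ σ ∈ (K.restrictOfFinrankEqTwo (by decide) Φ.Kcm Φ.finrank_Kcm).layerSubgroup n, χ σ = 1)
    (𝔟 : Ideal (𝓞 Φ.Kcm)) {m : ℕ} (hm : PadicInt.toZModPow n ((D : KatoExpPadicDatum hγ Φ).artExp 𝔟) = (m : ZMod (7 ^ n))) (y : Φ.IK.H) :
    D.val χ (D.sigma 𝔟 • y) = ((((χ Φ.γK)⁻¹ : ℂˣ)) : ℂ) ^ m * D.val χ y :=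
  val_binomialSeries_smul (D.val_T χ ⟨n, hχ⟩) (Φ.inv_chi_γK_pow_eq_one χ hχ) hm y

/-- ★ **THE EIGEN-LEMMA (the (T-c) interface of block (R))**: `val χ (σ_𝔟 • y) = χ(𝔟)⁻¹ · val χ y` for every `χ` of
finite level `n` and every admissible `𝔟` (from (e1), (art) at a natural lift, and the `ω_n`-congruence of `p`-adic powers).
[cite: Kato2004Asterisque, (15.12.2) (p. 263) and Thm. 12.5 (1) (p. 221)] [cite: Washington1997, §13.2] -/
theorem val_sigma_smul (χ : absoluteGaloisGroup Φ.Kcm →ₜ* ℂˣ) {n : ℕ}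
    (hχ : ∀ σ ∈ (K.restrictOfFinrankEqTwo (by decide) Φ.Kcm Φ.finrank_Kcm).layerSubgroup n, χ σ = 1)
    {𝔟 : Ideal (𝓞 Φ.Kcm)} (h𝔟 : IsTwist 7 Φ.𝔣 𝔟) (y : Φ.IK.H) :
    (D : KatoExpPadicDatum hγ Φ).val χ (D.sigma 𝔟 • y) = (heckeIdealValue χ 𝔟)⁻¹ * D.val χ y := by
  obtain ⟨m, hm⟩ := D.exists_nat_toZModPow_artExp 𝔟 n
  rw [D.val_sigma_smul_eq_pow χ hχ 𝔟 hm, D.inv_heckeIdealValue_eq_pow χ hχ h𝔟 hm]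

/-- `charEval` of `σ_𝔟` at level `n`: `charEval 7 ι u n (σ_𝔟) = u^m` for `u^{7^n} = 1` and a natural lift `m` of
`κ(𝔟) mod 7^n`. [cite: Washington1997, §13.2 and §7.1 Prop. 7.2] -/
theorem charEval_sigma {B : Type*} [CommRing B] (ι : ℤ_[7] →+* B) {u : B} {n : ℕ} (hu : u ^ 7 ^ n = 1)
    (𝔟 : Ideal (𝓞 Φ.Kcm)) {m : ℕ} (hm : PadicInt.toZModPow n ((D : KatoExpPadicDatum hγ Φ).artExp 𝔟) = (m : ZMod (7 ^ n))) :
    charEval 7 ι u n (D.sigma 𝔟) = u ^ m :=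
  charEval_binomialSeries 7 ι hu hm

/-- The (eZ′) values of the ★-class are NON-ZERO at primitive level `n + 1 ≥ n₀ + 1` where `Lf 1 ≠ 0`.
[cite: Kato2004Asterisque, Thm. 12.5 (2) (p. 221) and 13.5 (p. 227)] -/
theorem val_zStar_ne_zero {n : ℕ} (hn : (D : KatoExpPadicDatum hγ Φ).n₀ ≤ n) (χ : absoluteGaloisGroup Φ.Kcm →ₜ* ℂˣ)
    (hχ : ∀ σ ∈ (K.restrictOfFinrankEqTwo (by decide) Φ.Kcm Φ.finrank_Kcm).layerSubgroup (n + 1), χ σ = 1)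
    (hprim : IsPrimitiveRoot (((χ Φ.γK : ℂˣ)) : ℂ) (7 ^ (n + 1))) {Lf : ℂ → ℂ}
    (hLf : CM.IsDepletedHeckeL Φ.ψ χ (7 * (7 * F.d)) Lf) (hL1 : Lf 1 ≠ 0) : D.val χ D.zStar ≠ 0 :=
  ne_zero_of_padicValueLaw Φ D.ι₇ D.α_ne_zero (D.val_zStar n hn χ hχ hprim Lf hLf) hL1

/-! ## §D  The EXPLICIT data of block (R) over `KatoExpPadicDatum` (7-adic currency: `C α`, `N(α) ∈ ℤ₇`, `jα = v₇(N(α))`) -/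

/-- **`D.xTilde 𝔟 ∈ Λ_O`** — `2N𝔟 − (b₀(𝔟) + b₁(𝔟)·π)·σ_𝔟` (verbatim). [cite: Kato2004Asterisque, (15.12.2) (p. 263) and 15.14 (p. 264)] -/
def xTilde (𝔟 : Ideal (𝓞 Φ.Kcm)) : Φ.R :=
  algebraMap (IwasawaAlgebra 7) Φ.R
      ((((2 * Ideal.absNorm 𝔟 : ℕ) : ℤ) : IwasawaAlgebra 7) - (D.bCoef₀ 𝔟 : IwasawaAlgebra 7) * D.sigma 𝔟) -
    algebraMap (IwasawaAlgebra 7) Φ.R (D.bCoef₁ 𝔟 : IwasawaAlgebra 7) *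
      algebraMap (IwasawaAlgebra 7) Φ.R (D.sigma 𝔟) * Φ.π

/-- Unfolding `xTilde`. [cite: Kato2004Asterisque, (15.12.2) (p. 263)] -/
theorem xTilde_def (𝔟 : Ideal (𝓞 Φ.Kcm)) :
    (D : KatoExpPadicDatum hγ Φ).xTilde 𝔟 =
      algebraMap (IwasawaAlgebra 7) Φ.R
          ((((2 * Ideal.absNorm 𝔟 : ℕ) : ℤ) : IwasawaAlgebra 7) - (D.bCoef₀ 𝔟 : IwasawaAlgebra 7) * D.sigma 𝔟) -
        algebraMap (IwasawaAlgebra 7) Φ.R (D.bCoef₁ 𝔟 : IwasawaAlgebra 7) *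
          algebraMap (IwasawaAlgebra 7) Φ.R (D.sigma 𝔟) * Φ.π :=
  rfl

/-- **`D.cZ ∈ Λ_O`** — the explicit right constant `(C α₀ − C α₁·π)·7^e · uStar⁻¹·7^k·u·π^a` of block (R); the 7-adic pair
enters ONLY through `algebraMap Λ Λ_O ∘ PowerSeries.C` (no `ι₇`; pen D1086 (c4)). [cite: Kato2004Asterisque, (15.16.1) (p. 265) and Thm. 12.5 (1) (p. 221)] -/
def cZ : Φ.R :=
  ((algebraMap (IwasawaAlgebra 7) Φ.R (PowerSeries.C D.α₀) -
        algebraMap (IwasawaAlgebra 7) Φ.R (PowerSeries.C D.α₁) * Φ.π) *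
      algebraMap (IwasawaAlgebra 7) Φ.R ((7 ^ D.e : ℤ) : IwasawaAlgebra 7)) *
    (algebraMap (IwasawaAlgebra 7) Φ.R (↑(D.uStar⁻¹) : IwasawaAlgebra 7) *
      (algebraMap (IwasawaAlgebra 7) Φ.R ((7 : IwasawaAlgebra 7) ^ Φ.k) * ((Φ.u : Φ.R) * Φ.π ^ Φ.a)))

/-- `N(α) = α₀² + 7α₁² ∈ ℤ₇` (7-adic currency of `KatoExpDatum.normA : ℕ`). [cite: Kato2004Asterisque, (15.16.1) (p. 265)] -/
def normA : ℤ_[7] := D.α₀ ^ 2 + 7 * D.α₁ ^ 2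

/-- Unfolding `normA`. [cite: Kato2004Asterisque, (15.16.1) (p. 265)] -/
theorem normA_def : (D : KatoExpPadicDatum hγ Φ).normA = D.α₀ ^ 2 + 7 * D.α₁ ^ 2 := rfl

/-- `N(α) ≠ 0` (`x² + 7y²` is anisotropic over `ℤ₇`). [cite: Kato2004Asterisque, (15.16.1) (p. 265)] -/
theorem normA_ne_zero : (D : KatoExpPadicDatum hγ Φ).normA ≠ 0 := normSeven_ne_zero D.α_ne_zero

/-- `jα = v₇(N(α)) : ℕ` through Mathlib's `PadicInt.valuation : ℤ_[p] → ℕ` (7-adic currency of `KatoExpDatum.jα =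
normA.factorization 7`). [cite: Kato2004Asterisque, (15.16.1) (p. 265)] -/
def jα : ℕ := D.normA.valuation

/-- Unfolding `jα`. [cite: Kato2004Asterisque, (15.16.1) (p. 265)] -/
theorem jα_def : (D : KatoExpPadicDatum hγ Φ).jα = (D.α₀ ^ 2 + 7 * D.α₁ ^ 2).valuation := rfl

/-- The unit part `N(α)/7^{jα} ∈ ℤ₇ˣ` (`PadicInt.unitCoeff`). [cite: Kato2004Asterisque, (15.16.1) (p. 265)] -/
def normUnit : ℤ_[7]ˣ := PadicInt.unitCoeff D.normA_ne_zero

/-- `N(α) = (N(α)/7^{jα})·7^{jα}`. [cite: Kato2004Asterisque, (15.16.1) (p. 265)] -/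
theorem normA_eq_normUnit_mul_pow : (D : KatoExpPadicDatum hγ Φ).normA = (D.normUnit : ℤ_[7]) * 7 ^ D.jα :=
  eq_unitCoeff_mul_pow_valuation D.normA_ne_zero

/-- `7^{jα} ∣ N(α)`. [cite: Kato2004Asterisque, (15.16.1) (p. 265)] -/
theorem seven_pow_jα_dvd_normA : (7 : ℤ_[7]) ^ (D : KatoExpPadicDatum hγ Φ).jα ∣ D.α₀ ^ 2 + 7 * D.α₁ ^ 2 :=
  pow_valuation_dvd D.normA_ne_zero

/-- **`D.wα ∈ Λ_O`** — the explicit left unit `v^{jα}·(2·N(α)/7^{jα})` of block (R), the unit part through `C`.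
[cite: Kato2004Asterisque, (15.16.1) (p. 265)] -/
def wα : Φ.R :=
  (Φ.v : Φ.R) ^ D.jα * algebraMap (IwasawaAlgebra 7) Φ.R ((2 : IwasawaAlgebra 7) * PowerSeries.C (D.normUnit : ℤ_[7]))

/-- `wα` is a unit of `Λ_O` (`2 ∈ ℤ₇ˣ`, `N(α)/7^{jα} ∈ ℤ₇ˣ`, `v ∈ Λ_Oˣ`). [cite: Washington1997, §7.1] -/
theorem isUnit_wα : IsUnit (D : KatoExpPadicDatum hγ Φ).wα := by
  have h2 : IsUnit (2 : IwasawaAlgebra 7) := by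
    have h := GenusDatum.isUnit_two.map (PowerSeries.C (R := ℤ_[7]))
    rwa [map_ofNat] at h
  have hC : IsUnit (PowerSeries.C (D.normUnit : ℤ_[7]) : IwasawaAlgebra 7) := D.normUnit.isUnit.map _
  exact (Φ.v.isUnit.pow D.jα).mul ((h2.mul hC).map (algebraMap (IwasawaAlgebra 7) Φ.R))

/-- `C (2N(α)) = (2·C(N(α)/7^{jα}))·7^{jα}` in `Λ`. [cite: Kato2004Asterisque, (15.16.1) (p. 265)] -/
theorem C_two_mul_normA :
    (PowerSeries.C (2 * ((D : KatoExpPadicDatum hγ Φ).α₀ ^ 2 + 7 * D.α₁ ^ 2)) : IwasawaAlgebra 7) =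
      ((2 : IwasawaAlgebra 7) * PowerSeries.C (D.normUnit : ℤ_[7])) * (7 : IwasawaAlgebra 7) ^ D.jα := by
  rw [← D.normA_def, D.normA_eq_normUnit_mul_pow, map_mul, map_mul, map_pow, map_ofNat, map_ofNat]
  ring

/-- The left constant of ★ is `wα·π^{m₀ + 2jα}` (`2N(α) = (2N(α)/7^{jα})·7^{jα}`, `7 = v·π²`).
[cite: Kato2004Asterisque, (15.16.1) (p. 265)] -/
theorem sTwoSided_eq (m₀ : ℕ) :
    Φ.π ^ m₀ * algebraMap (IwasawaAlgebra 7) Φ.R (PowerSeries.C (2 * ((D : KatoExpPadicDatum hγ Φ).α₀ ^ 2 + 7 * D.α₁ ^ 2))) =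
      D.wα * Φ.π ^ (m₀ + 2 * D.jα) := by
  have h7 : algebraMap (IwasawaAlgebra 7) Φ.R 7 = (Φ.v : Φ.R) * Φ.π ^ 2 := by
    rw [map_ofNat]; exact Φ.seven_eq
  rw [D.C_two_mul_normA, map_mul, map_pow, h7, KatoExpPadicDatum.wα, pow_add, pow_mul, mul_pow]
  ring

/-- In `Λ`: `(C α₀)² + 7(C α₁)² = C(N(α)) ≠ 0`. [cite: Kato2004Asterisque, (15.16.1) (p. 265)] -/
theorem C_sq_add_seven_mul_C_sq_ne_zero :
    (PowerSeries.C (D : KatoExpPadicDatum hγ Φ).α₀ : IwasawaAlgebra 7) ^ 2 + 7 * (PowerSeries.C D.α₁ : IwasawaAlgebra 7) ^ 2 ≠ 0 := by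
  have h : (PowerSeries.C D.α₀ : IwasawaAlgebra 7) ^ 2 + 7 * (PowerSeries.C D.α₁ : IwasawaAlgebra 7) ^ 2 =
      PowerSeries.C D.normA := by
    rw [KatoExpPadicDatum.normA, map_add, map_mul, map_pow, map_pow, map_ofNat]
  rw [h, Ne, ← map_zero (PowerSeries.C (R := ℤ_[7])), (PowerSeries.C_injective).eq_iff]
  exact D.normA_ne_zero

/-- `2·((C α₀)² + 7(C α₁)²) = C(2N(α))` in `Λ` (the left scalar of the module identity vs. the left constant of ★).
[cite: Kato2004Asterisque, (15.16.1) (p. 265)] -/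
theorem two_mul_C_sq_add_eq :
    (2 * ((PowerSeries.C (D : KatoExpPadicDatum hγ Φ).α₀ : IwasawaAlgebra 7) ^ 2 + 7 * (PowerSeries.C D.α₁ : IwasawaAlgebra 7) ^ 2)) =
      PowerSeries.C (2 * (D.α₀ ^ 2 + 7 * D.α₁ ^ 2)) := by
  rw [map_mul, map_add, map_mul, map_pow, map_pow, map_ofNat, map_ofNat]

/-- `D.cZ` with its casts normalised: `(C α₀ − C α₁·π)·7^e·(A(uStar⁻¹)·(7^k·(u·π^a)))`. [cite: Kato2004Asterisque, (15.16.1) (p. 265)] -/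
theorem cZ_eq :
    (D : KatoExpPadicDatum hγ Φ).cZ = ((algebraMap (IwasawaAlgebra 7) Φ.R (PowerSeries.C D.α₀) -
          algebraMap (IwasawaAlgebra 7) Φ.R (PowerSeries.C D.α₁) * Φ.π) * (7 : Φ.R) ^ D.e) *
      (algebraMap (IwasawaAlgebra 7) Φ.R (↑(D.uStar⁻¹) : IwasawaAlgebra 7) *
        ((7 : Φ.R) ^ Φ.k * ((Φ.u : Φ.R) * Φ.π ^ Φ.a))) := by
  simp only [KatoExpPadicDatum.cZ, map_pow, map_ofNat, Int.cast_pow, Int.cast_ofNat]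

/-- **The D916 divisibility input from the integer inequality, general gauge** (the (PK) predicate `PeriodPositionFieldAt`
written out, 7-adic currency): for any cofactor `t′ = w′·π^{m′}`, `m₀ + jα ≤ 2e + 2k + a + m′ ⟹ Φ.π ^ (m₀ + 2·jα) ∣ D.cZ * t′`.
[cite: Kato2004Asterisque, (15.16.1) (p. 265)] -/
theorem pow_dvd_cZ_mul_of_leAt (t' w' : Φ.R) (m₀ m' : ℕ) (ht' : t' = w' * Φ.π ^ m')
    (h : m₀ + (D : KatoExpPadicDatum hγ Φ).jα ≤ 2 * D.e + 2 * Φ.k + Φ.a + m') : Φ.π ^ (m₀ + 2 * D.jα) ∣ D.cZ * t' := by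
  have hle : m₀ + 2 * (D.α₀ ^ 2 + 7 * D.α₁ ^ 2).valuation ≤
      (D.α₀ ^ 2 + 7 * D.α₁ ^ 2).valuation + (2 * D.e + 2 * Φ.k + Φ.a) + m' := by
    change m₀ + 2 * D.jα ≤ D.jα + (2 * D.e + 2 * Φ.k + Φ.a) + m'
    omega
  have key := pow_dvd_constZ_mul_of_le ((algebraMap (IwasawaAlgebra 7) Φ.R).comp (PowerSeries.C (R := ℤ_[7])))
    Φ.π (Φ.v : Φ.R) Φ.seven_eq D.α₀ D.α₁ D.α_ne_zero D.e Φ.k Φ.a m₀ m'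
    (algebraMap (IwasawaAlgebra 7) Φ.R (↑(D.uStar⁻¹) : IwasawaAlgebra 7)) (Φ.u : Φ.R) w' hle
  rw [D.cZ_eq, ht']
  exact key

/-- **Unit-`t` gauge** (the (PK) predicate `PeriodPositionField` written out): `t′ = w′·π^{m₀}` and `jα ≤ 2e + 2k + a ⟹
Φ.π ^ (m₀ + 2·jα) ∣ D.cZ * t′`. [cite: Kato2004Asterisque, (15.16.1) (p. 265)] -/
theorem pow_dvd_cZ_mul_of_le (t' w' : Φ.R) (m₀ : ℕ) (ht' : t' = w' * Φ.π ^ m₀) (h : (D : KatoExpPadicDatum hγ Φ).jα ≤ 2 * D.e + 2 * Φ.k + Φ.a) :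
    Φ.π ^ (m₀ + 2 * D.jα) ∣ D.cZ * t' :=
  D.pow_dvd_cZ_mul_of_leAt t' w' m₀ m₀ ht' (by omega)

end KatoExpPadicDatum

end Frame

end Summit.BirchSwinnertonDyer.Rank1Residual.Additive.GenusSeven

end
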